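import Summits.BirchSwinnertonDyer.Rank1Residual.P2.CongruentNumberPairsAtTwoDoorAAtlasThreeCensus
import Summits.BirchSwinnertonDyer.Rank1Residual.P2.CongruentNumberPairsAtTwoGenusPointData
import Summits.BirchSwinnertonDyer.Rank1Residual.P2.CongruentClassSevenKernelGenusParity
import Literature.NumberTheory.EllipticCurves.HeathBrown1994.CongruentTwoSelmerFengXiongFamilies
import HarnessLib

/-!
# Sub-lane «bsd-p2»: the `ρ`-FREE DOOR A at `2` IN CONFIGURATION CURRENCY — the `ω(n) = 3` ATLAS,
# file 2/2: transfer and door corollaries (classes `n ≡ 5, 7 (mod 8)`; p2-typer GEN 6, ATLAS-A3)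

HONEST FRAMING (sub-lane «bsd-p2», run/shared/lean/b2b/bsd-rank1-residual/p2/, verbatim in every
file): the target of record is the FULL Birch–Swinnerton-Dyer formula for EVERY analytic-rank `≤ 1`
`E/ℚ` at ALL primes INCLUDING `2`; the odd-prime class ledger is referee A's; the `2`-part is OPEN
(cells O1 = X5 ∖ CM and O12 = the CM corner) and under census by «bsd-p2». Census / instrument
output at `2` = EVIDENCE / conjecture items with held-out validation, NEVER a Literature fact;
certificates close PAIRS (one isogeny class, `p = 2`), never classes. This file asserts NO
arithmetic fact: its theorems are kernel theorems MODULO the displayed facts named in their binders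
{`tyz_genusPointData` (TYZ §3 displayed, p2-lit-1), GZK, Monsky 1994 odd, Rédei–Reichardt}; the reach
counts quoted below are the typer's desk EVIDENCE until cross-read by p2-monsky-x; families, never classes.

WHAT IT DOES. File 1/2 (`…DoorAAtlasThreeCensus.lean`) reads Monsky's odd matrix and DOOR A on a Legendre
configuration and decides the `ω(n) = 3` census. Here: (§3) for distinct odd primes the REAL Monsky matrix
IS the reading of the configuration — `monskyMatrixOdd_eq_monskyCfgOdd` (any `k`; `kroneckerBit_eq_addLegendreSym`,
`addLegendreSym_two_eq`, `addLegendreSym_neg_two_eq`), `monskySelmerRankOdd_eq_one_iff_card_ker`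
(`s(n) = 1` iff a `2`-element kernel), `cfg_three_eq_betaOf` (the triple's bits = `betaOf` of the three
upper bits, quadratic reciprocity); (§4) the discharged door `…_of_genusPointData` composed with
p2-monsky-lit's `sigma1Cfg_eq_natCast_genusSum₁` / `sigma2Cfg_add_gBitSub_eq_natCast_genusSum₂'`:
* `rankOne_sha_bsdp_two_congruentNumberCurve_of_doorACfg`: `doorACfg` of the triple's configuration ⟹
  `r_an = 1`, rank `1`, `Ш[2^∞] = 0`, `BSD(E_n, 2)`;
* `bsdp_two_congruentNumberCurve_three_primes_of_doorACfg`: the UPPER-BITS FORM — fix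
  `(r₀ r₁ r₂ : Fin 8) (s₀ s₁ s₂ : ZMod 2)` with `doorACfg r (betaOf r s) = true` (`by decide`); then EVERY
  triple of distinct primes realising the configuration gives `r_an = 1 ∧ BSD(E_{p₀p₁p₂}, 2)` — each of the
  `180` good ordered configurations (desk count) is a uniform infinite family in ONE line;
* `rankOne_sha_bsdp_two_congruentNumberCurve_three_primes_seven` / `forall_…_three_primes_seven`:
  CLASS `7`, `ω = 3`: `s(n) = 1` ALONE (`monskySelmerRankOdd p = 1`, resp. a `2`-element kernel of
  `monskyMatrixOdd p`) gives `BSD(E_n, 2)` — no Faulkner–James kernel, no `ρ`, no `hgen`;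
* `rankOne_sha_bsdp_two_congruentNumberCurve_three_primes_five`: CLASS `5`, `ω = 3`: `s(n) = 1` and NOT
  the exceptional configuration `p₅·q₇·r₇`, `(q/p) = (r/p) = −1` (`exceptionalFiveCfg … = false`) gives
  `BSD(E_n, 2)`; (§5) on the exceptional family the KERNEL DATUM `selmerRankOne_genusSums_even_of_exceptionalFive`:
  `s(n) = 1` and `Σ₁`, `Σ₂′` EVEN (TYZ Thm 1.2 silent; smallest member `805 = 5·7·23`) — NOTHING claimed on BSD.
Reach (desk EVIDENCE, `p2/typer/cn/pop3.py`): odd square-free `n = pqr < 3·10⁶` in classes `5/7`: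
`188 048`; `doorACfg` `151 507` (`73 822` + `77 685`); exceptional `4 879`; `s(n) ≥ 3` `31 662`.
Nothing booked; no mark moved. Unit `b2b-bsdres-p2-typer` GEN 6; NEW file. References:
[HeathBrown1994SelmerCongruentII] Appendix (Monsky), p. 39 L10–L33; [TianYuanZhang2017] Thm 1.2, Thm 3.5,
§1 (1.1); [LiMa2008] Thm 0.4; [IrelandRosen1990] Ch. 5 §1–§2; [Miller2011LMS] Def 1.1; TYPING-PLAN.md v1.3.
-/

open Matrix Finset NumberField Literature.NumberTheory.EllipticCurves
  Literature.NumberTheory.EllipticCurves.Rank1Residual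
  Literature.NumberTheory.EllipticCurves.Rank1Residual.Typed
  Literature.NumberTheory.EllipticCurves.HeathBrown1994
  Literature.NumberTheory.EllipticCurves.HeathBrown1994.Families
  Literature.NumberTheory.EllipticCurves.TianYuanZhang2017
  Literature.NumberTheory.EllipticCurves.Tian2014
  Literature.NumberTheory.QuadraticFields.RedeiReichardt

set_option autoImplicit false

namespace Summit.BirchSwinnertonDyer.Rank1Residual.P2
/-! ## §3 Transfer: the prime tuple's Monsky matrix IS the reading of its configuration -/

section Transfer

variable {t : ℕ} (p : Fin t → ℕ)

/-- **Monsky's odd matrix is a function of the Legendre configuration**: for distinct odd primes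
`p₁, …, p_t`, `monskyMatrixOdd p = monskyCfgOdd (pᵢ mod 8) ([(p_b/p_a) = −1])` — `A`'s entries are the
symbol bits (`kroneckerBit_eq_addLegendreSym`), `D₂ = χ₈`, `D₋₂ = χ₈ + χ₄` (`addLegendreSym_two_eq`,
`addLegendreSym_neg_two_eq`). [cite: HeathBrown1994SelmerCongruentII, Appendix (Monsky), typescript p. 39 L10–L32]
[cite: IrelandRosen1990, Ch. 5 §1 Prop. 5.1.2–5.1.3] -/
theorem monskyMatrixOdd_eq_monskyCfgOdd (hp : ∀ i, (p i).Prime) (hp2 : ∀ i, p i ≠ 2)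
    (hinj : Function.Injective p) :
    monskyMatrixOdd p = monskyCfgOdd (fun i => p i % 8) (fun a b => kroneckerBit (p b) (p a)) := by
  have hodd : ∀ i, Odd (p i) := fun i => (hp i).odd_of_ne_two (hp2 i)
  have hA : legendreMatrix p = legendreCfg (fun a b => kroneckerBit (p b) (p a)) := by
    unfold legendreMatrix legendreCfg
    exact of_rowsum_congr fun a b hab =>
      (kroneckerBit_eq_addLegendreSym (hp a) (hp2 a)
        (intCast_natCast_prime_ne_zero (hp b) (hp a) fun h => hab (hinj h).symm)).symm
  have hD2 : legendreDiagonal p 2 = Matrix.diagonal fun i => chi8Bit (p i % 8) := by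
    unfold legendreDiagonal
    congr 1; funext i
    rw [addLegendreSym_two_eq (hodd i), chi8Bit_mod_eight]; rfl
  have hDm2 : legendreDiagonal p (-2) =
      Matrix.diagonal fun i => chi8Bit (p i % 8) + chi4Bit (p i % 8) := by
    unfold legendreDiagonal
    congr 1; funext i
    rw [addLegendreSym_neg_two_eq (hodd i), addLegendreSym_two_eq (hodd i), chi8Bit_mod_eight,
      chi4Bit_mod_eight]; rfl
  unfold monskyMatrixOdd monskyCfgOdd
  rw [hA, hD2, hDm2]

/-- The kernel count of Monsky's matrix is the kernel count read on the configuration.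
[cite: HeathBrown1994SelmerCongruentII, Appendix (Monsky), typescript p. 39 L33] -/
theorem card_ker_monskyMatrixOdd_eq_cfg (hp : ∀ i, (p i).Prime) (hp2 : ∀ i, p i ≠ 2)
    (hinj : Function.Injective p) :
    Fintype.card {v : Fin t ⊕ Fin t → ZMod 2 // monskyMatrixOdd p *ᵥ v = 0} =
      Fintype.card {v : Fin t ⊕ Fin t → ZMod 2 //
        monskyCfgOdd (fun i => p i % 8) (fun a b => kroneckerBit (p b) (p a)) *ᵥ v = 0} :=
  Fintype.card_congr (Equiv.subtypeEquivRight fun v => by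
    rw [monskyMatrixOdd_eq_monskyCfgOdd p hp hp2 hinj])

/-- `s(n) = 1` (Monsky's `2k − rank M`) iff Monsky's matrix has a `2`-element kernel (rank–nullity,
`card_ker_mulVec_eq_sum`). [cite: HeathBrown1994SelmerCongruentII, Appendix (Monsky), typescript p. 39 L33] -/
theorem monskySelmerRankOdd_eq_one_iff_card_ker :
    monskySelmerRankOdd p = 1 ↔
      Fintype.card {v : Fin t ⊕ Fin t → ZMod 2 // monskyMatrixOdd p *ᵥ v = 0} = 2 := by
  rw [card_ker_mulVec_eq_sum, monskySelmerRankOdd]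
  constructor
  · intro h; rw [h, pow_one]
  · intro h
    exact Nat.pow_right_injective (le_refl 2) (h.trans (pow_one 2).symm)

variable (p : Fin 3 → ℕ)

/-- The configuration of a triple of distinct odd primes, packaged on `Fin 8` residues and the three
upper symbol bits (the lower ones by quadratic reciprocity, `kroneckerBit_swap`; diagonal `kroneckerBit_self`).
[cite: IrelandRosen1990, Ch. 5 §2 Thm. 1 (quadratic reciprocity)] -/
theorem cfg_three_eq_betaOf (hp : ∀ i, (p i).Prime) (hp2 : ∀ i, p i ≠ 2)
    (hinj : Function.Injective p) :
    ∃ r₀ r₁ r₂ : Fin 8, (r₀.val = p 0 % 8 ∧ r₁.val = p 1 % 8 ∧ r₂.val = p 2 % 8) ∧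
      (fun i => p i % 8) = ![r₀.val, r₁.val, r₂.val] ∧
      (fun a b => kroneckerBit (p b) (p a)) = betaOf ![r₀.val, r₁.val, r₂.val]
        ![kroneckerBit (p 1) (p 0), kroneckerBit (p 2) (p 0), kroneckerBit (p 2) (p 1)] := by
  have h01 : p 0 ≠ p 1 := fun h => absurd (hinj h) (by decide)
  have h02 : p 0 ≠ p 2 := fun h => absurd (hinj h) (by decide)
  have h12 : p 1 ≠ p 2 := fun h => absurd (hinj h) (by decide)
  refine ⟨⟨p 0 % 8, Nat.mod_lt _ (by norm_num)⟩, ⟨p 1 % 8, Nat.mod_lt _ (by norm_num)⟩,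
    ⟨p 2 % 8, Nat.mod_lt _ (by norm_num)⟩, ⟨rfl, rfl, rfl⟩, ?_, ?_⟩
  · funext i; fin_cases i <;> rfl
  · funext a b
    fin_cases a <;> fin_cases b
    · simpa [betaOf] using kroneckerBit_self (hp 0)
    · simp [betaOf]
    · simp [betaOf]
    · simp [betaOf, chi4Bit_mod_eight, kroneckerBit_swap (hp 0) (hp 1) (hp2 0) (hp2 1) h01, mul_comm]
    · simpa [betaOf] using kroneckerBit_self (hp 1)
    · simp [betaOf]
    · simp [betaOf, chi4Bit_mod_eight, kroneckerBit_swap (hp 0) (hp 2) (hp2 0) (hp2 2) h02, mul_comm]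
    · simp [betaOf, chi4Bit_mod_eight, kroneckerBit_swap (hp 1) (hp 2) (hp2 1) (hp2 2) h12, mul_comm]
    · simpa [betaOf] using kroneckerBit_self (hp 2)

end Transfer

/-! ## §4 The door in configuration currency, and the `ω = 3` corollaries -/

section Door

variable (p : Fin 3 → ℕ)

/-- **DOOR A IN CONFIGURATION CURRENCY (`ω(n) = 3`).** For distinct primes `p₀, p₁, p₂` whose Legendre
configuration satisfies the decidable predicate `doorACfg`: `ord_{s=1} L(E_n, s) = 1`, rank `1`,
`Ш(E_n)[2^∞] = 0` and `BSD(E_n, 2)`, `n = p₀p₁p₂` — modulo the displayed facts `hTYZ`, `hGZK`, `hM`, `hR`;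
no `ρ`, no L-value, no per-curve input beyond the configuration.
[cite: TianYuanZhang2017, Thm. 1.2, Thm. 3.5 and §1 (1.1)]
[cite: HeathBrown1994SelmerCongruentII, Appendix (Monsky), typescript p. 39 L10–L33]
[cite: Miller2011LMS, Def. 1.1 (arXiv:1010.2431 p. 3)] -/
theorem rankOne_sha_bsdp_two_congruentNumberCurve_of_doorACfg (hTYZ : tyz_genusPointData)
    (hGZK : rank_eq_analyticRank_of_analyticRank_le_one) (hM : monsky_card_selmerGroup_two_odd)
    (hR : redeiReichardt_fourTwoCard_classGroup)
    (hp : ∀ i, (p i).Prime) (hinj : Function.Injective p) {n : ℕ} (hn : ∏ i, p i = n)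
    (hcfg : doorACfg (fun i => p i % 8) (fun a b => kroneckerBit (p b) (p a)) = true) :
    (congruentNumberCurve n).analyticRank = 1 ∧ (congruentNumberCurve n).mordellWeilRank = 1 ∧
      AddCommGroup.primaryComponent (congruentNumberCurve n).sha 2 = ⊥ ∧
      BSDp (congruentNumberCurve n) 2 := by
  have hn3 : n = p 0 * p 1 * p 2 := by rw [← hn, Fin.prod_univ_three]
  obtain ⟨h8r, hker, hgen⟩ := (doorACfg_eq_true_iff _ _).mp hcfg
  have h8 : n % 8 = 5 ∨ n % 8 = 7 := by rwa [mod_eight_mul_three, ← hn3] at h8r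
  have hp2 : ∀ i, p i ≠ 2 := by
    intro i hi
    have hdvd : p i ∣ n := hn ▸ Finset.dvd_prod_of_mem p (Finset.mem_univ i)
    rw [hi] at hdvd
    rcases h8 with h | h <;> omega
  have hodd : ∀ i, Odd (p i) := fun i => (hp i).odd_of_ne_two (hp2 i)
  have h8' : (p 0 * p 1 * p 2) % 8 = 5 ∨ (p 0 * p 1 * p 2) % 8 = 6 ∨ (p 0 * p 1 * p 2) % 8 = 7 := by
    rcases h8 with h | h
    · exact Or.inl (hn3 ▸ h)
    · exact Or.inr (Or.inr (hn3 ▸ h))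
  have hgen' : Odd (genusSum₁ n fun d => genusClassNumber (GenusField d)) ∨
      Odd (genusSum₂' n fun d => genusClassNumber (GenusField d)) := by
    rw [sigma1Cfg_eq_natCast_genusSum₁ p hR hp hp2 hinj,
      sigma2Cfg_add_gBitSub_eq_natCast_genusSum₂' p hR hp hp2 hinj h8', ← hn3,
      ZMod.natCast_eq_one_iff_odd, ZMod.natCast_eq_one_iff_odd] at hgen
    exact hgen
  have hker' : Fintype.card {v : Fin 3 ⊕ Fin 3 → ZMod 2 // monskyMatrixOdd p *ᵥ v = 0} = 2 := by
    rw [card_ker_monskyMatrixOdd_eq_cfg p hp hp2 hinj]; exact hker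
  exact rankOne_sha_bsdp_two_congruentNumberCurve_of_genusPointData p hTYZ hGZK hM hp hodd hinj hn h8
    (fun i j => addLegendreSym (p j) (p i)) (fun i => addLegendreSym 2 (p i))
    (fun i => addLegendreSym (-2) (p i)) (fun _ _ => rfl) (fun _ => rfl) (fun _ => rfl) hker' hgen'

/-- **EVERY `ω = 3` DOOR-A FAMILY AS A ONE-LINER (upper-bits form).** Fix residues `r₀, r₁, r₂ (mod 8)`
and symbol bits `s₀ = [(p₁/p₀) = −1]`, `s₁ = [(p₂/p₀) = −1]`, `s₂ = [(p₂/p₁) = −1]` with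
`doorACfg r (betaOf r s) = true` (a closed term: `by decide`); then for ALL distinct primes `p₀, p₁, p₂`
realising the configuration, `ord_{s=1} L(E_{p₀p₁p₂}, s) = 1` and `BSD(E_{p₀p₁p₂}, 2)`, modulo `hTYZ`,
`hGZK`, `hM`, `hR`. [cite: TianYuanZhang2017, Thm. 1.2, Thm. 3.5 and §1 (1.1)]
[cite: IrelandRosen1990, Ch. 5 §2 Thm. 1] [cite: Miller2011LMS, Def. 1.1 (arXiv:1010.2431 p. 3)] -/
theorem bsdp_two_congruentNumberCurve_three_primes_of_doorACfg (hTYZ : tyz_genusPointData)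
    (hGZK : rank_eq_analyticRank_of_analyticRank_le_one) (hM : monsky_card_selmerGroup_two_odd)
    (hR : redeiReichardt_fourTwoCard_classGroup) (r₀ r₁ r₂ : Fin 8) (s₀ s₁ s₂ : ZMod 2)
    (hcfg : doorACfg ![r₀.val, r₁.val, r₂.val]
      (betaOf ![r₀.val, r₁.val, r₂.val] ![s₀, s₁, s₂]) = true)
    {p₀ p₁ p₂ : ℕ} (hp₀ : p₀.Prime) (hp₁ : p₁.Prime) (hp₂ : p₂.Prime)
    (h01 : p₀ ≠ p₁) (h02 : p₀ ≠ p₂) (h12 : p₁ ≠ p₂)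
    (hr₀ : p₀ % 8 = r₀.val) (hr₁ : p₁ % 8 = r₁.val) (hr₂ : p₂ % 8 = r₂.val)
    (hs₀ : kroneckerBit p₁ p₀ = s₀) (hs₁ : kroneckerBit p₂ p₀ = s₁) (hs₂ : kroneckerBit p₂ p₁ = s₂) :
    haveI := isElliptic_congruentNumberCurve
      (Nat.mul_ne_zero (Nat.mul_ne_zero hp₀.ne_zero hp₁.ne_zero) hp₂.ne_zero)
    (congruentNumberCurve (p₀ * p₁ * p₂)).analyticRank = 1 ∧
      BSDp (congruentNumberCurve (p₀ * p₁ * p₂)) 2 := by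
  set p : Fin 3 → ℕ := ![p₀, p₁, p₂] with hpdef
  have hp : ∀ i, (p i).Prime := by intro i; fin_cases i <;> assumption
  have hinj : Function.Injective p := by
    intro i j h
    fin_cases i <;> fin_cases j <;> simp_all [p]
  have hn : ∏ i, p i = p₀ * p₁ * p₂ := by rw [Fin.prod_univ_three]; rfl
  -- the residues are odd (the guard of `doorACfg`), hence no prime is `2`
  have hg := ((doorACfg_eq_true_iff _ _).mp hcfg).1
  simp only [Matrix.cons_val_zero, Matrix.cons_val_one, Matrix.head_cons, Matrix.cons_val_two,
    Matrix.tail_cons] at hg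
  have hoddr : r₀.val % 2 = 1 ∧ r₁.val % 2 = 1 ∧ r₂.val % 2 = 1 := by
    have h2 : (r₀.val * r₁.val * r₂.val) % 2 = 1 := by rcases hg with h | h <;> omega
    have h' := Nat.odd_iff.mpr h2
    rw [Nat.odd_mul, Nat.odd_mul] at h'
    exact ⟨Nat.odd_iff.mp h'.1.1, Nat.odd_iff.mp h'.1.2, Nat.odd_iff.mp h'.2⟩
  have hp2 : ∀ i, p i ≠ 2 := by
    intro i; fin_cases i
    · show p₀ ≠ 2; omega
    · show p₁ ≠ 2; omega
    · show p₂ ≠ 2; omega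
  obtain ⟨r₀', r₁', r₂', ⟨e₀, e₁, e₂⟩, hRfun, hBfun⟩ := cfg_three_eq_betaOf p hp hp2 hinj
  have er₀ : r₀' = r₀ := Fin.ext (by rw [e₀]; exact hr₀)
  have er₁ : r₁' = r₁ := Fin.ext (by rw [e₁]; exact hr₁)
  have er₂ : r₂' = r₂ := Fin.ext (by rw [e₂]; exact hr₂)
  have hcfg' : doorACfg (fun i => p i % 8) (fun a b => kroneckerBit (p b) (p a)) = true := by
    rw [hRfun, hBfun, er₀, er₁, er₂]
    simpa [p, hs₀, hs₁, hs₂] using hcfg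
  have h := rankOne_sha_bsdp_two_congruentNumberCurve_of_doorACfg p hTYZ hGZK hM hR hp hinj hn hcfg'
  exact ⟨h.1, h.2.2.2⟩

/-- **CLASS `7`, `ω(n) = 3`: `s(n) = 1` ALONE GIVES `BSD(E_n, 2)`.** For distinct primes `p₀, p₁, p₂` with
`p₀p₁p₂ ≡ 7 (mod 8)`: if Monsky's matrix `monskyMatrixOdd p` has a `2`-element kernel then `r_an = 1`,
rank `1`, `Ш[2^∞] = 0`, `BSD(E_n, 2)` (`n = p₀p₁p₂`), modulo `hTYZ`, `hGZK`, `hM`, `hR` — the genus condition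
is AUTOMATIC (census `sigmaCfg_of_card_ker_seven`); compare p2-monsky-lit's
`bsdp_two_congruentNumberCurve_of_card_ker_fj_three'`, which asks in addition for the Faulkner–James
kernel `#NS(G(−n)) = 4`. [cite: TianYuanZhang2017, Thm. 1.2, Thm. 3.5 and §1 (1.1)]
[cite: HeathBrown1994SelmerCongruentII, Appendix (Monsky), typescript p. 39 L10–L33]
[cite: Miller2011LMS, Def. 1.1 (arXiv:1010.2431 p. 3)] -/
theorem rankOne_sha_bsdp_two_congruentNumberCurve_three_primes_seven (hTYZ : tyz_genusPointData)
    (hGZK : rank_eq_analyticRank_of_analyticRank_le_one) (hM : monsky_card_selmerGroup_two_odd)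
    (hR : redeiReichardt_fourTwoCard_classGroup)
    (hp : ∀ i, (p i).Prime) (hinj : Function.Injective p) {n : ℕ} (hn : ∏ i, p i = n)
    (h7 : n % 8 = 7)
    (hker : Fintype.card {v : Fin 3 ⊕ Fin 3 → ZMod 2 // monskyMatrixOdd p *ᵥ v = 0} = 2) :
    (congruentNumberCurve n).analyticRank = 1 ∧ (congruentNumberCurve n).mordellWeilRank = 1 ∧
      AddCommGroup.primaryComponent (congruentNumberCurve n).sha 2 = ⊥ ∧
      BSDp (congruentNumberCurve n) 2 := by
  have hn3 : n = p 0 * p 1 * p 2 := by rw [← hn, Fin.prod_univ_three]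
  have hp2 := ne_two_of_prod_eq p hn h7
  obtain ⟨r₀, r₁, r₂, ⟨e₀, e₁, e₂⟩, hRfun, hBfun⟩ := cfg_three_eq_betaOf p hp hp2 hinj
  have h7r : (r₀.val * r₁.val * r₂.val) % 8 = 7 := by
    rw [e₀, e₁, e₂, mod_eight_mul_three, ← hn3, h7]
  have hkerC := hker
  rw [card_ker_monskyMatrixOdd_eq_cfg p hp hp2 hinj, hRfun, hBfun] at hkerC
  have hsig := sigmaCfg_of_card_ker_seven r₀ r₁ r₂ _ _ _ h7r hkerC
  have hgood : doorACfg (fun i => p i % 8) (fun a b => kroneckerBit (p b) (p a)) = true := by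
    rw [hRfun, hBfun, doorACfg_eq_true_iff]
    exact ⟨Or.inr h7r, hkerC, hsig⟩
  exact rankOne_sha_bsdp_two_congruentNumberCurve_of_doorACfg p hTYZ hGZK hM hR hp hinj hn hgood

/-- **`BSD(E_n, 2)` FOR ALL `n = p₀p₁p₂ ≡ 7 (mod 8)` WITH `s(n) = 1`** (`∀`-form; `s(n)` = Monsky's
`2k − rank M`, `monskySelmerRankOdd`), modulo `hTYZ`, `hGZK`, `hM`, `hR`; nothing per curve but Monsky's rank.
[cite: TianYuanZhang2017, Thm. 1.2 and Thm. 3.5] [cite: HeathBrown1994SelmerCongruentII, Appendix (Monsky), typescript p. 39 L33]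
[cite: Miller2011LMS, Def. 1.1 (arXiv:1010.2431 p. 3)] -/
theorem forall_bsdp_two_congruentNumberCurve_three_primes_seven (hTYZ : tyz_genusPointData)
    (hGZK : rank_eq_analyticRank_of_analyticRank_le_one) (hM : monsky_card_selmerGroup_two_odd)
    (hR : redeiReichardt_fourTwoCard_classGroup) :
    ∀ p : Fin 3 → ℕ, (∀ i, (p i).Prime) → Function.Injective p → (∏ i, p i) % 8 = 7 →
      monskySelmerRankOdd p = 1 → BSDp (congruentNumberCurve (∏ i, p i)) 2 :=
  fun p hp hinj h7 hs =>
    (rankOne_sha_bsdp_two_congruentNumberCurve_three_primes_seven p hTYZ hGZK hM hR hp hinj rfl h7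
      ((monskySelmerRankOdd_eq_one_iff_card_ker p).mp hs)).2.2.2

/-- **CLASS `5`, `ω(n) = 3`: `s(n) = 1` GIVES `BSD(E_n, 2)` OFF THE EXCEPTIONAL FAMILY.** For distinct
primes with `p₀p₁p₂ ≡ 5 (mod 8)`, Monsky kernel `2`, and configuration NOT of the shape `p₅·q₇·r₇`,
`(q/p) = (r/p) = −1` (`exceptionalFiveCfg … = false`, decidable on the residues and symbol bits):
`r_an = 1`, rank `1`, `Ш[2^∞] = 0`, `BSD(E_n, 2)`, modulo `hTYZ`, `hGZK`, `hM`, `hR`. On the exceptional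
family NOTHING is claimed (there `Σ₁`, `Σ₂′` are even and TYZ Thm 1.2 is silent).
[cite: TianYuanZhang2017, Thm. 1.2, Thm. 3.5 and §1 (1.1)]
[cite: HeathBrown1994SelmerCongruentII, Appendix (Monsky), typescript p. 39 L10–L33]
[cite: Miller2011LMS, Def. 1.1 (arXiv:1010.2431 p. 3)] -/
theorem rankOne_sha_bsdp_two_congruentNumberCurve_three_primes_five (hTYZ : tyz_genusPointData)
    (hGZK : rank_eq_analyticRank_of_analyticRank_le_one) (hM : monsky_card_selmerGroup_two_odd)
    (hR : redeiReichardt_fourTwoCard_classGroup)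
    (hp : ∀ i, (p i).Prime) (hinj : Function.Injective p) {n : ℕ} (hn : ∏ i, p i = n)
    (h5 : n % 8 = 5)
    (hker : Fintype.card {v : Fin 3 ⊕ Fin 3 → ZMod 2 // monskyMatrixOdd p *ᵥ v = 0} = 2)
    (hexc : exceptionalFiveCfg (fun i => p i % 8) (fun a b => kroneckerBit (p b) (p a)) = false) :
    (congruentNumberCurve n).analyticRank = 1 ∧ (congruentNumberCurve n).mordellWeilRank = 1 ∧
      AddCommGroup.primaryComponent (congruentNumberCurve n).sha 2 = ⊥ ∧
      BSDp (congruentNumberCurve n) 2 := by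
  have hn3 : n = p 0 * p 1 * p 2 := by rw [← hn, Fin.prod_univ_three]
  have hp2 : ∀ i, p i ≠ 2 := by
    intro i hi
    have hdvd : p i ∣ n := hn ▸ Finset.dvd_prod_of_mem p (Finset.mem_univ i)
    rw [hi] at hdvd
    omega
  obtain ⟨r₀, r₁, r₂, ⟨e₀, e₁, e₂⟩, hRfun, hBfun⟩ := cfg_three_eq_betaOf p hp hp2 hinj
  have h5r : (r₀.val * r₁.val * r₂.val) % 8 = 5 := by
    rw [e₀, e₁, e₂, mod_eight_mul_three, ← hn3, h5]
  have hkerC := hker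
  rw [card_ker_monskyMatrixOdd_eq_cfg p hp hp2 hinj, hRfun, hBfun] at hkerC
  rw [hRfun, hBfun] at hexc
  have hsig := (sigmaCfg_iff_of_card_ker_five r₀ r₁ r₂ _ _ _ h5r hkerC).mpr hexc
  have hgood : doorACfg (fun i => p i % 8) (fun a b => kroneckerBit (p b) (p a)) = true := by
    rw [hRfun, hBfun, doorACfg_eq_true_iff]
    exact ⟨Or.inl h5r, hkerC, hsig⟩
  exact rankOne_sha_bsdp_two_congruentNumberCurve_of_doorACfg p hTYZ hGZK hM hR hp hinj hn hgood

/-- **A SAMPLE FAMILY IN ONE LINE: `n = p₁·q₃·r₅` with `(q/p) = −1`.** For ALL primes `p ≡ 1`, `q ≡ 3`,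
`r ≡ 5 (mod 8)` with `(q/p) = −1` (the symbols `(r/p)`, `(r/q)` free): `BSD(E_{pqr}, 2)`, modulo `hTYZ`,
`hGZK`, `hM`, `hR` — the upper-bits door with `doorACfg` decided on the `4` configurations
`(1, 3, 5; 1, s₁, s₂)`. (Template for any of the `180` good configurations.)
[cite: TianYuanZhang2017, Thm. 1.2, Thm. 3.5 and §1 (1.1)] [cite: IrelandRosen1990, Ch. 5 §1 Prop. 5.1.2]
[cite: Miller2011LMS, Def. 1.1 (arXiv:1010.2431 p. 3)] -/
theorem forall_bsdp_two_congruentNumberCurve_one_three_five (hTYZ : tyz_genusPointData)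
    (hGZK : rank_eq_analyticRank_of_analyticRank_le_one) (hM : monsky_card_selmerGroup_two_odd)
    (hR : redeiReichardt_fourTwoCard_classGroup) :
    ∀ p q r : ℕ, p.Prime → q.Prime → r.Prime → p % 8 = 1 → q % 8 = 3 → r % 8 = 5 →
      jacobiSym q p = -1 → BSDp (congruentNumberCurve (p * q * r)) 2 := by
  intro p q r hp hq hr h1 h3 h5 hj
  have key : ∀ s₁ s₂ : ZMod 2, doorACfg ![1, 3, 5] (betaOf ![1, 3, 5] ![1, s₁, s₂]) = true := by
    decide
  have hpq : p ≠ q := fun h => by omega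
  have hpr : p ≠ r := fun h => by omega
  have hqr : q ≠ r := fun h => by omega
  have hs₀ : kroneckerBit q p = 1 := by
    rw [kroneckerBit_eq_bitOf hp (by omega) (intCast_natCast_prime_ne_zero hq hp hpq.symm)]
    simp [bitOf, hj]
  exact (bsdp_two_congruentNumberCurve_three_primes_of_doorACfg hTYZ hGZK hM hR ⟨1, by norm_num⟩
    ⟨3, by norm_num⟩ ⟨5, by norm_num⟩ 1 (kroneckerBit r p) (kroneckerBit r q) (key _ _) hp hq hr hpq
    hpr hqr h1 h3 h5 hs₀ rfl rfl).2

/-! ## §5 The silent family as a kernel datum: `s(n) = 1` yet `Σ₁`, `Σ₂′` EVEN (nothing claimed about BSD) -/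

/-- On the exceptional class-`5` configurations (`p₅·q₇·r₇`, `(q/p) = (r/p) = −1`; `6` ordered) the
readings are: Monsky kernel `2`, `Σ₁ ≡ 0`, `Σ₂′ ≡ 0 (mod 2)`. `decide`.
[cite: TianYuanZhang2017, Thm. 1.2] [cite: HeathBrown1994SelmerCongruentII, Appendix (Monsky), typescript p. 39 L27–L33] -/
theorem cfg_of_exceptionalFive : ∀ (r₀ r₁ r₂ : Fin 8) (s₀ s₁ s₂ : ZMod 2),
    exceptionalFiveCfg ![r₀.val, r₁.val, r₂.val] (betaOf ![r₀.val, r₁.val, r₂.val] ![s₀, s₁, s₂])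
      = true →
    Fintype.card {v : Fin 3 ⊕ Fin 3 → ZMod 2 //
      monskyCfgOdd ![r₀.val, r₁.val, r₂.val] (betaOf ![r₀.val, r₁.val, r₂.val] ![s₀, s₁, s₂])
        *ᵥ v = 0} = 2 ∧
    sigma1Cfg ![r₀.val, r₁.val, r₂.val] (betaOf ![r₀.val, r₁.val, r₂.val] ![s₀, s₁, s₂]) = 0 ∧
    sigma2Cfg ![r₀.val, r₁.val, r₂.val] (betaOf ![r₀.val, r₁.val, r₂.val] ![s₀, s₁, s₂]) +
      gBitSub ![0, 1, 2] ![r₀.val, r₁.val, r₂.val] (betaOf ![r₀.val, r₁.val, r₂.val] ![s₀, s₁, s₂])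
        = 0 := by
  decide

/-- **THE TYZ-SILENT `ω = 3` FAMILY, AS A KERNEL DATUM (nothing claimed about BSD).** For distinct primes
`p₀, p₁, p₂` in the exceptional configuration (`p₅·q₇·r₇` with `(q/p) = (r/p) = −1`): Monsky's
`s(n) = 1` (so, granted `r_an = 1`, rank `1` and `Ш[2] = 0` would follow as in DOOR A) AND both genus sums
`Σ₁(n)`, `Σ₂′(n)` over `GenusField` are EVEN — the hypothesis of Tian–Yuan–Zhang Thm 1.2 (and of U⁺'s
contrapositive) FAILS, so no door of the tree decides `𝓛(n) mod 2` here; modulo Rédei–Reichardt (`hR`)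
only. Smallest member `805 = 5·7·23`. A NAMED TARGET for the ideation seats (p2-lead T-122 (5)).
[cite: TianYuanZhang2017, Thm. 1.2 and §1 (1.1)] [cite: LiMa2008, Thm. 0.4]
[cite: HeathBrown1994SelmerCongruentII, Appendix (Monsky), typescript p. 39 L33] -/
theorem selmerRankOne_genusSums_even_of_exceptionalFive (hR : redeiReichardt_fourTwoCard_classGroup)
    (hp : ∀ i, (p i).Prime) (hinj : Function.Injective p) {n : ℕ} (hn : ∏ i, p i = n)
    (hexc : exceptionalFiveCfg (fun i => p i % 8) (fun a b => kroneckerBit (p b) (p a)) = true) :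
    monskySelmerRankOdd p = 1 ∧ Even (genusSum₁ n fun d => genusClassNumber (GenusField d)) ∧
      Even (genusSum₂' n fun d => genusClassNumber (GenusField d)) := by
  have hn3 : n = p 0 * p 1 * p 2 := by rw [← hn, Fin.prod_univ_three]
  have hres : ∀ j, p j % 8 = 5 ∨ p j % 8 = 7 := by
    obtain ⟨i, hi5, hij⟩ := of_decide_eq_true hexc
    intro j
    by_cases hji : j = i
    · subst hji; left; simpa [Nat.mod_mod] using hi5
    · right; simpa [Nat.mod_mod] using (hij j hji).1
  have hp2 : ∀ j, p j ≠ 2 := fun j h => by have := hres j; rw [h] at this; omega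
  obtain ⟨r₀, r₁, r₂, ⟨e₀, e₁, e₂⟩, hRfun, hBfun⟩ := cfg_three_eq_betaOf p hp hp2 hinj
  rw [hRfun, hBfun] at hexc
  obtain ⟨hker, hs1, hs2⟩ := cfg_of_exceptionalFive r₀ r₁ r₂ _ _ _ hexc
  -- residues in `{5, 7}` multiply to `5` or `7 (mod 8)`
  have h8' : (p 0 * p 1 * p 2) % 8 = 5 ∨ (p 0 * p 1 * p 2) % 8 = 6 ∨ (p 0 * p 1 * p 2) % 8 = 7 := by
    rw [← mod_eight_mul_three]
    rcases hres 0 with a | a <;> rcases hres 1 with b | b <;> rcases hres 2 with c | c <;>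
      rw [a, b, c] <;> decide
  rw [← hBfun, ← hRfun] at hker hs1 hs2
  refine ⟨(monskySelmerRankOdd_eq_one_iff_card_ker p).mpr
    (by rw [card_ker_monskyMatrixOdd_eq_cfg p hp hp2 hinj]; exact hker), ?_, ?_⟩
  · rw [sigma1Cfg_eq_natCast_genusSum₁ p hR hp hp2 hinj, ← hn3] at hs1
    exact ZMod.natCast_eq_zero_iff_even.mp hs1
  · rw [sigma2Cfg_add_gBitSub_eq_natCast_genusSum₂' p hR hp hp2 hinj h8', ← hn3] at hs2
    exact ZMod.natCast_eq_zero_iff_even.mp hs2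

end Door

end Summit.BirchSwinnertonDyer.Rank1Residual.P2
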